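import Mathlib
import HarnessLib
import Summits.NavierStokesRegularity.NavierStokesRegularity.Theorems.ChiralWindowDoorDefs

/-!
# Door S20 «ChiralWindowDoor» — the SYMMETRISATION IDENTITY behind B1′/B2′ (nsreg-p1 `r19/Symmetrisation.lean`, landed)

Door S20 of nsreg-p1's local Type-I door family (`HOME/ns-regularity-ideate-p1/r19/ROUND-19-DRAFT.md`, `R19-LINE.md`
§B1′/B2′; DESIGN-ONLY, route NOT born).  For an EVEN kernel `K`, a weight `a` and a vector field `f` on `ℝ³`
(everything under explicit integrability hypotheses, which the B1′ prover discharges for the truncated kernels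
`K_ε = lamKTrunc ε` and passes to the limit):

  `∫ a(x) ⟪f(x), ∫ K(x−y)(f(x)−f(y)) dy⟫ dx = ¼ ∬ (a(x)+a(y)) K(x−y) ‖f(x)−f(y)‖² + ½ ∫ ‖f(x)‖² (∫ K(x−y)(a(x)−a(y)) dy) dx`,

i.e. `h(a,f) = G(a,f) + ½∫‖f‖² Λa` — the localised helicity of a CHIRAL field (`curl f = Λ f`) is the non-negative
weighted Gagliardo form up to a weight-Laplacian error.  Pure measure theory: Fubini + the swap symmetry +
finite-dimensional algebra.  The integrands `symF`, `symG`, `symS` are the substrate's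
(`…Theorems.ChiralWindowDoorDefs`).

* `symm_pointwise`, `symF_add_swap`, `integral_symS_swap` — the algebra and the swap;
* `locHelicity_symmetrisation` — **the identity**;
* `integral_symG_nonneg`, `gagliardo_le_locHelicity_add` — the B1′ SHAPE `¼∬(a x+a y)K‖f x−f y‖² ≤ ∫a⟪f, L_K f⟫ + ½∫‖f‖²|L_K a|`;
* `firstDiff_eq_secondDiff` — `∫K(x−y)(f x − f y)dy = ½∫K(z)(2f x − f(x+z) − f(x−z))dz` for even `K` (the bridge from the
  truncated first-difference operator `L_K` to the second-difference form of `fracLapHalf`).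

Texts and proofs: nsreg-p1 g16 (`r19/Symmetrisation.lean` sha16 61034c34402cf948, `import Mathlib` only), landed here
with credit over the tree substrate.  Seat nsreg-p6 g11 (THEOREMS-ONLY door sequels, DIRECTOR-NS g8 #32 (2)/#36).
WHAT THIS IS NOT: not NS regularity (Clay A); not B1′ itself (the truncation limit `ε → 0`, the kernel bounds
`|Λ(η_R²)| ≲ R⁻¹ ∧ R³‖x‖⁻⁴` and the decay bookkeeping remain); no route is opened.
-/

noncomputable section

-- the summit and its single sub-problem share the name (CONVENTIONS §1), as in every Theorems file
set_option linter.dupNamespace false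

namespace Summit.NavierStokesRegularity.NavierStokesRegularity.Theorems.ChiralWindowDoorSymmetrisation

open MeasureTheory
open scoped RealInnerProductSpace
open Summit.NavierStokesRegularity.NavierStokesRegularity.Theorems.ChiralWindowDoorDefs

/-- The pointwise algebra of the symmetrisation. -/
theorem symm_pointwise (u w : EuclideanSpace ℝ (Fin 3)) (α β k : ℝ) :
    α * (k * inner ℝ u (u - w)) + β * (k * inner ℝ w (w - u)) =
      (1 / 2 : ℝ) * ((α + β) * (k * ‖u - w‖ ^ 2)) + (1 / 2 : ℝ) * ((α - β) * k * (‖u‖ ^ 2 - ‖w‖ ^ 2)) := by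
  have h1 : inner ℝ u (u - w) = ‖u‖ ^ 2 - inner ℝ u w := by
    rw [inner_sub_right, real_inner_self_eq_norm_sq]
  have h2 : inner ℝ w (w - u) = ‖w‖ ^ 2 - inner ℝ u w := by
    rw [inner_sub_right, real_inner_self_eq_norm_sq, real_inner_comm]
  have h3 : ‖u - w‖ ^ 2 = ‖u‖ ^ 2 - 2 * inner ℝ u w + ‖w‖ ^ 2 := norm_sub_sq_real u w
  rw [h1, h2, h3]; ring

variable {a : EuclideanSpace ℝ (Fin 3) → ℝ} {f : EuclideanSpace ℝ (Fin 3) → EuclideanSpace ℝ (Fin 3)}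
  {K : EuclideanSpace ℝ (Fin 3) → ℝ}

/-- Symmetrising the helicity-type integrand: `F(x,y) + F(y,x) = ½ G(x,y) + ½ (S(x,y) + S(y,x))` for even `K`. -/
theorem symF_add_swap (hK : ∀ z, K (-z) = K z) (p : EuclideanSpace ℝ (Fin 3) × EuclideanSpace ℝ (Fin 3)) :
    symF a f K p + symF a f K p.swap =
      (1 / 2 : ℝ) * symG a f K p + (1 / 2 : ℝ) * (symS a f K p + symS a f K p.swap) := by
  rcases p with ⟨x, y⟩
  have hk : K (y - x) = K (x - y) := by rw [← hK (y - x), neg_sub]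
  simp only [symF, symG, symS, Prod.swap_prod_mk, hk]
  rw [symm_pointwise (f x) (f y) (a x) (a y) (K (x - y))]
  ring

/-- `∫ S∘swap = ∫ S` (no integrability needed: `integral_prod_swap`). -/
theorem integral_symS_swap :
    ∫ p : EuclideanSpace ℝ (Fin 3) × EuclideanSpace ℝ (Fin 3), symS a f K p.swap = ∫ p : EuclideanSpace ℝ (Fin 3) × EuclideanSpace ℝ (Fin 3), symS a f K p := by
  rw [Measure.volume_eq_prod]
  exact integral_prod_swap (symS a f K)

/-- **The symmetrisation identity.** -/
theorem locHelicity_symmetrisation (hK : ∀ z, K (-z) = K z)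
    (hF : Integrable (symF a f K)) (hG : Integrable (symG a f K)) (hS : Integrable (symS a f K))
    (hLf : ∀ x, Integrable (fun y => K (x - y) • (f x - f y))) :
    ∫ x, a x * inner ℝ (f x) (∫ y, K (x - y) • (f x - f y)) =
      (1 / 4 : ℝ) * (∫ p : EuclideanSpace ℝ (Fin 3) × EuclideanSpace ℝ (Fin 3), symG a f K p) +
        (1 / 2 : ℝ) * ∫ x, ‖f x‖ ^ 2 * ∫ y, K (x - y) * (a x - a y) := by
  -- Step 1: LHS = ∫ F over the product.
  have h1 : ∫ x, a x * inner ℝ (f x) (∫ y, K (x - y) • (f x - f y)) = ∫ p : EuclideanSpace ℝ (Fin 3) × EuclideanSpace ℝ (Fin 3), symF a f K p := by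
    rw [Measure.volume_eq_prod, integral_prod (symF a f K) (by simpa [Measure.volume_eq_prod] using hF)]
    refine integral_congr_ae (Filter.Eventually.of_forall fun x => ?_)
    simp only [symF]
    rw [integral_const_mul, ← integral_inner (hLf x)]
    congr 1
    refine integral_congr_ae (Filter.Eventually.of_forall fun y => ?_)
    simp only [real_inner_smul_right]
  -- Step 2: ∫ F = ∫ F∘swap.
  have h2 : ∫ p : EuclideanSpace ℝ (Fin 3) × EuclideanSpace ℝ (Fin 3), symF a f K p.swap = ∫ p : EuclideanSpace ℝ (Fin 3) × EuclideanSpace ℝ (Fin 3), symF a f K p := by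
    rw [Measure.volume_eq_prod]; exact integral_prod_swap (symF a f K)
  have hFs : Integrable (fun p : EuclideanSpace ℝ (Fin 3) × EuclideanSpace ℝ (Fin 3) => symF a f K p.swap) := by
    have := hF.swap
    simpa [Measure.volume_eq_prod, Function.comp_def] using this
  have hSs : Integrable (fun p : EuclideanSpace ℝ (Fin 3) × EuclideanSpace ℝ (Fin 3) => symS a f K p.swap) := by
    have := hS.swap
    simpa [Measure.volume_eq_prod, Function.comp_def] using this
  -- Step 3: 2 ∫ F = ½ ∫ G + ½ (∫ S − ∫ S∘swap) = ½ ∫ G + ∫ S.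
  have h3 : 2 * ∫ p : EuclideanSpace ℝ (Fin 3) × EuclideanSpace ℝ (Fin 3), symF a f K p =
      (1 / 2 : ℝ) * (∫ p : EuclideanSpace ℝ (Fin 3) × EuclideanSpace ℝ (Fin 3), symG a f K p) + ∫ p : EuclideanSpace ℝ (Fin 3) × EuclideanSpace ℝ (Fin 3), symS a f K p := by
    have hsum : ∫ p : EuclideanSpace ℝ (Fin 3) × EuclideanSpace ℝ (Fin 3), (symF a f K p + symF a f K p.swap) =
        ∫ p : EuclideanSpace ℝ (Fin 3) × EuclideanSpace ℝ (Fin 3), ((1 / 2 : ℝ) * symG a f K p + (1 / 2 : ℝ) * (symS a f K p + symS a f K p.swap)) :=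
      integral_congr_ae (Filter.Eventually.of_forall fun p => symF_add_swap hK p)
    have hI1 : Integrable (fun p : EuclideanSpace ℝ (Fin 3) × EuclideanSpace ℝ (Fin 3) => (1 / 2 : ℝ) * symG a f K p) := hG.const_mul _
    have hI2 : Integrable (fun p : EuclideanSpace ℝ (Fin 3) × EuclideanSpace ℝ (Fin 3) => (1 / 2 : ℝ) * (symS a f K p + symS a f K p.swap)) :=
      (hS.add hSs).const_mul _
    rw [integral_add hF hFs, h2, integral_add hI1 hI2, integral_const_mul, integral_const_mul,
      integral_add hS hSs, integral_symS_swap] at hsum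
    linarith
  -- Step 4: ∫ S = ∫ ‖f x‖² (∫ K (a x − a y)).
  have h4 : ∫ p : EuclideanSpace ℝ (Fin 3) × EuclideanSpace ℝ (Fin 3), symS a f K p = ∫ x, ‖f x‖ ^ 2 * ∫ y, K (x - y) * (a x - a y) := by
    rw [Measure.volume_eq_prod, integral_prod (symS a f K) (by simpa [Measure.volume_eq_prod] using hS)]
    refine integral_congr_ae (Filter.Eventually.of_forall fun x => ?_)
    simp only [symS]
    rw [← integral_const_mul]
    refine integral_congr_ae (Filter.Eventually.of_forall fun y => ?_)
    ring
  rw [h1]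
  linarith [h3, h4]

/-- The weighted Gagliardo form is nonnegative for nonnegative weight and kernel. -/
theorem integral_symG_nonneg (ha : ∀ x, 0 ≤ a x) (hK0 : ∀ z, 0 ≤ K z) :
    0 ≤ ∫ p : EuclideanSpace ℝ (Fin 3) × EuclideanSpace ℝ (Fin 3), symG a f K p :=
  integral_nonneg fun p => by
    have h1 := ha p.1; have h2 := ha p.2; have h3 := hK0 (p.1 - p.2)
    unfold symG; positivity

/-- **B1′ shape: the Gagliardo form is controlled by the localised "helicity" plus the weight-Laplacian error**
`¼∬(a(x)+a(y))K|f(x)−f(y)|² ≤ ∫ a⟨f, L_K f⟩ + ½∫‖f‖²|L_K a|` (for a chiral field, `L_K f → curl f` as the truncation is removed). -/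
theorem gagliardo_le_locHelicity_add (hK : ∀ z, K (-z) = K z)
    (hF : Integrable (symF a f K)) (hG : Integrable (symG a f K)) (hS : Integrable (symS a f K))
    (hLf : ∀ x, Integrable (fun y => K (x - y) • (f x - f y))) :
    (1 / 4 : ℝ) * (∫ p : EuclideanSpace ℝ (Fin 3) × EuclideanSpace ℝ (Fin 3), symG a f K p) ≤
      (∫ x, a x * inner ℝ (f x) (∫ y, K (x - y) • (f x - f y))) +
        (1 / 2 : ℝ) * ∫ x, ‖f x‖ ^ 2 * |∫ y, K (x - y) * (a x - a y)| := by
  rw [locHelicity_symmetrisation hK hF hG hS hLf]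
  have h1 : -(∫ x, ‖f x‖ ^ 2 * ∫ y, K (x - y) * (a x - a y)) ≤
      |∫ x, ‖f x‖ ^ 2 * ∫ y, K (x - y) * (a x - a y)| := neg_le_abs _
  have h2 : |∫ x, ‖f x‖ ^ 2 * ∫ y, K (x - y) * (a x - a y)| ≤
      ∫ x, |‖f x‖ ^ 2 * ∫ y, K (x - y) * (a x - a y)| := abs_integral_le_integral_abs
  have h3 : ∫ x, |‖f x‖ ^ 2 * ∫ y, K (x - y) * (a x - a y)| = ∫ x, ‖f x‖ ^ 2 * |∫ y, K (x - y) * (a x - a y)| :=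
    integral_congr_ae (Filter.Eventually.of_forall fun x => by
      show |‖f x‖ ^ 2 * ∫ y, K (x - y) * (a x - a y)| = ‖f x‖ ^ 2 * |∫ y, K (x - y) * (a x - a y)|
      rw [abs_mul, abs_of_nonneg (by positivity : (0 : ℝ) ≤ ‖f x‖ ^ 2)])
  linarith

/-- **First differences = second differences** for an even kernel (the bridge from `L_K f` to the `fracLapHalf` form):
`∫ K(x−y)(f x − f y) dy = ½ ∫ K(z)(2 f x − f(x+z) − f(x−z)) dz`. -/
theorem firstDiff_eq_secondDiff (hK : ∀ z, K (-z) = K z) (x : EuclideanSpace ℝ (Fin 3))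
    (h1 : Integrable (fun z => K z • (f x - f (x + z))))
    (h2 : Integrable (fun z => K z • (f x - f (x - z)))) :
    ∫ y, K (x - y) • (f x - f y) = (1 / 2 : ℝ) • ∫ z, K z • ((2 : ℝ) • f x - f (x + z) - f (x - z)) := by
  have hA : ∫ y, K (x - y) • (f x - f y) = ∫ z, K z • (f x - f (x - z)) := by
    rw [← integral_sub_left_eq_self (μ := volume) (fun y => K (x - y) • (f x - f y)) x]
    refine integral_congr_ae (Filter.Eventually.of_forall fun z => ?_)
    simp only [sub_sub_cancel]
  have hB : ∫ z, K z • (f x - f (x - z)) = ∫ z, K z • (f x - f (x + z)) := by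
    rw [← integral_neg_eq_self (μ := volume) (fun z => K z • (f x - f (x - z)))]
    refine integral_congr_ae (Filter.Eventually.of_forall fun z => ?_)
    simp only [hK, sub_neg_eq_add]
  have hsum : ∫ z, K z • ((2 : ℝ) • f x - f (x + z) - f (x - z)) =
      (∫ z, K z • (f x - f (x + z))) + ∫ z, K z • (f x - f (x - z)) := by
    rw [← integral_add h1 h2]
    refine integral_congr_ae (Filter.Eventually.of_forall fun z => ?_)
    show K z • ((2 : ℝ) • f x - f (x + z) - f (x - z)) = K z • (f x - f (x + z)) + K z • (f x - f (x - z))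
    rw [← smul_add, two_smul]; congr 1; abel
  rw [hA, hsum, ← hB, smul_add, ← add_smul]
  norm_num

end Summit.NavierStokesRegularity.NavierStokesRegularity.Theorems.ChiralWindowDoorSymmetrisation
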